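import Summits.CriticalPhenomena.CardyFormulaZ2.Theorems.CardyIKTransportCornerLineDescentOfTameStubs
import Summits.CriticalPhenomena.CardyFormulaZ2.Theorems.CardyIKTransportCornerLineDescentOfIKBondBridge

/-!
# The crux `CardyIKTransport.CornerLineDescent` (stmt-CriticalPhenomena-10964): its irreducible residual in tree
# vocabulary — rate-free corner irrelevance at TAME rectangles — and its logical position

Support file (`--supports stmt-CriticalPhenomena-10964`) of the line `symmetric-seed-second-order`, lead c5 (2026-08-16).
Vocabulary of `Theorems/CardyIKTransportCornerLineDescentLine.lean` (`gaugeCrossingProb`, `bondStdCrossingProb`, `pIK`,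
`cornerLineDescent_iff`); "tame" is written out inline as in `…OfTameStubs.lean` (carrier `= G(𝔻)`, `G` univalent on a
larger disc).

WHAT THIS FILE RECORDS (all glue over landed theorems; no new mathematics is claimed):

* `bondStdCardyAt_of_cornerIrrelevanceTame`, `cornerLineDescent_of_cornerIrrelevanceTame` — THE WEAKEST SUFFICIENT
  RESIDUAL the tree can state: if for every TAME conformal rectangle the isotropic-IK gauge (`p = p_IK`) and the frozen
  gauge (`p = 0`, renewal-grid bond model) have crude crossing probabilities differing by `o(1)` as `δ → 0⁺`, then the crux
  holds.  (Cardy for `P_IK` transfers along the vanishing difference to the frozen gauge at the rotated tame rectangle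
  `e^{iπ/4}R`; the unconditional frozen-end comparison `freezeComparisonAt` (p125041) gives crude standard bond-`ℤ²` Cardy at
  every tame `R`; tame rectangles suffice by `crudeBondCardy_of_tame` (p126699, unconditional).)  The line's two registered
  physics stubs (`stub_SummedInfluenceTame`, `stub_DiluteInfluenceTame`) imply this residual rectangle by rectangle through
  the landed Russo plumbing `stub_CornerIrrelevanceAt` (p126377) — they are a SUFFICIENT MECHANISM for it, with power rates.
* `cornerIrrelevanceTame_of_cardyIK_of_cornerLineDescent`, `cornerLineDescent_iff_cornerIrrelevanceTame_of_cardyIK` —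
  conversely, under the route's own hypothesis `CardyDiluteOrbit.CardyIK` (stmt-5913, character-for-character the
  antecedent of the crux) the crux IMPLIES corner irrelevance at every rectangle (p125041), in particular at tame ones; so
  under `CardyIK` the crux, rate-free corner irrelevance (all `R`), rate-free corner irrelevance (tame `R`) and the sibling
  crux `CardyDiluteOrbit.IKBondBridge` (stmt-5914, p107327) are ONE statement
  (`cornerLineDescent_tfae_position_of_cardyIK`).  That statement — one-lattice universality of crude crossing
  probabilities along the exactly self-dual corner-fugacity line `M(t,½)`, `t ∈ [0, √3/2]`, a non-FKG plaquette family
  (`Negative/CornerFaceNoMonotone`) — is an open problem (Schramm, ICM 2006, Problem 2.11 circle of questions; no theorem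
  in print compares crossing probabilities of two distinct `ℤ²`-based critical percolation models); see the crux census.

References: route files `Theses/CardyIKTransport.lean` (item 10964), `Theses/CardyDiluteOrbit.lean` (items 5913, 5914);
crux workfile `Cruxes/CornerLineDescent/Disproof.lean` §A.
-/

noncomputable section

namespace Summit.CriticalPhenomena.CardyFormulaZ2.Theorems.CornerLineDescent.SymmetricSeed

open scoped Topology
open Filter Set
open Literature.Probability.RandomPlanarGeometry

/-! ## §1 Rate-free corner irrelevance at tame rectangles suffices -/

/-- CRUDE STANDARD BOND-`ℤ²` CARDY AT A TAME RECTANGLE from Cardy for `P_IK` (all rectangles) and rate-free corner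
irrelevance at tame rectangles: transport a datum of the tame `R` to the tame rotated rectangle `e^{iπ/4}·R` (same real
preimages, `Freeze.exists_isUniformizing_map_mulLeft₀`; tameness by `tame_map_mulLeft₀`), subtract the vanishing difference
from the `P_IK` limit there, and pull back through the unconditional frozen-end comparison
(`Freeze.freezeHomogenisationAt_of_comparisonAt` ∘ `freezeComparisonAt`). [folklore] -/
theorem bondStdCardyAt_of_cornerIrrelevanceTame
    (h : ∀ R : ConformalRectangle,
      (∃ G : ℂ → ℂ, ∃ r : ℝ, 1 < r ∧ DifferentiableOn ℂ G (Metric.ball 0 r) ∧ Set.InjOn G (Metric.ball 0 r) ∧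
        R.carrier = G '' Metric.ball 0 1) →
      Tendsto (fun δ => gaugeCrossingProb pIK R δ - gaugeCrossingProb 0 R δ) (𝓝[>] 0) (𝓝 0))
    (hIK : ∀ R : ConformalRectangle, R.HasCrossingLimit (gaugeCrossingProb pIK R) cardyFunction)
    {R : ConformalRectangle}
    (hR : ∃ G : ℂ → ℂ, ∃ r : ℝ, 1 < r ∧ DifferentiableOn ℂ G (Metric.ball 0 r) ∧ Set.InjOn G (Metric.ball 0 r) ∧
      R.carrier = G '' Metric.ball 0 1) :
    R.HasCrossingLimit (bondStdCrossingProb R) cardyFunction := by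
  intro φ x hφx
  have hc : Complex.exp (((Real.pi / 4 : ℝ) : ℂ) * Complex.I) ≠ 0 := Complex.exp_ne_zero _
  obtain ⟨ψ, hψ⟩ := Freeze.exists_isUniformizing_map_mulLeft₀ R hc hφx
  have h0 : Tendsto (gaugeCrossingProb 0 (R.map (Homeomorph.mulLeft₀ _ hc))) (𝓝[>] 0)
      (𝓝 (cardyFunction (crossRatio x))) := by
    have h3 := (hIK _ ψ x hψ).sub (h _ (tame_map_mulLeft₀ hR hc))
    simp only [sub_sub_cancel, sub_zero] at h3
    exact h3
  exact Freeze.freezeHomogenisationAt_of_comparisonAt (freezeComparisonAt R) _ h0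

/-- THE CRUX ⟸ RATE-FREE CORNER IRRELEVANCE AT TAME RECTANGLES (the weakest sufficient residual in tree vocabulary):
`(∀ R tame, P_IK(R,δ) − P_0(R,δ) → 0) → CornerLineDescent`.  Given the crux's hypothesis `CardyIK`, §1's
`bondStdCardyAt_of_cornerIrrelevanceTame` gives crude standard bond-`ℤ²` Cardy at every tame rectangle, and
`crudeBondCardy_of_tame` (unconditional) at every conformal rectangle — the crux's consequent. [folklore] -/
theorem cornerLineDescent_of_cornerIrrelevanceTame :
    (∀ R : ConformalRectangle,
      (∃ G : ℂ → ℂ, ∃ r : ℝ, 1 < r ∧ DifferentiableOn ℂ G (Metric.ball 0 r) ∧ Set.InjOn G (Metric.ball 0 r) ∧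
        R.carrier = G '' Metric.ball 0 1) →
      Tendsto (fun δ => gaugeCrossingProb pIK R δ - gaugeCrossingProb 0 R δ) (𝓝[>] 0) (𝓝 0)) →
    Summit.CriticalPhenomena.CardyFormulaZ2.Theses.CardyIKTransport.CornerLineDescent := by
  intro h
  rw [cornerLineDescent_iff]
  intro hIK
  exact crudeBondCardy_of_tame fun R hR => bondStdCardyAt_of_cornerIrrelevanceTame h hIK hR

/-! ## §2 Under `CardyIK` the residual IS the crux (and is the sibling crux `IKBondBridge`) -/

/-- Conversely, under `CardyIK` the crux gives rate-free corner irrelevance at every rectangle (p125041,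
`cornerLineDescent_iff_cornerIrrelevance_of_cardyIK`), in particular at every tame one. [folklore] -/
theorem cornerIrrelevanceTame_of_cardyIK_of_cornerLineDescent
    (hIK : Summit.CriticalPhenomena.CardyFormulaZ2.Theses.CardyDiluteOrbit.CardyIK)
    (h : Summit.CriticalPhenomena.CardyFormulaZ2.Theses.CardyIKTransport.CornerLineDescent) :
    ∀ R : ConformalRectangle,
      (∃ G : ℂ → ℂ, ∃ r : ℝ, 1 < r ∧ DifferentiableOn ℂ G (Metric.ball 0 r) ∧ Set.InjOn G (Metric.ball 0 r) ∧
        R.carrier = G '' Metric.ball 0 1) →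
      Tendsto (fun δ => gaugeCrossingProb pIK R δ - gaugeCrossingProb 0 R δ) (𝓝[>] 0) (𝓝 0) :=
  fun R _ => (cornerLineDescent_iff_cornerIrrelevance_of_cardyIK hIK).1 h R

/-- UNDER THE ROUTE'S HYPOTHESIS `CardyIK` THE CRUX *IS* RATE-FREE CORNER IRRELEVANCE AT TAME RECTANGLES. [folklore] -/
theorem cornerLineDescent_iff_cornerIrrelevanceTame_of_cardyIK :
    Summit.CriticalPhenomena.CardyFormulaZ2.Theses.CardyDiluteOrbit.CardyIK →
    (Summit.CriticalPhenomena.CardyFormulaZ2.Theses.CardyIKTransport.CornerLineDescent ↔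
      ∀ R : ConformalRectangle,
        (∃ G : ℂ → ℂ, ∃ r : ℝ, 1 < r ∧ DifferentiableOn ℂ G (Metric.ball 0 r) ∧ Set.InjOn G (Metric.ball 0 r) ∧
          R.carrier = G '' Metric.ball 0 1) →
        Tendsto (fun δ => gaugeCrossingProb pIK R δ - gaugeCrossingProb 0 R δ) (𝓝[>] 0) (𝓝 0)) :=
  fun hIK => ⟨cornerIrrelevanceTame_of_cardyIK_of_cornerLineDescent hIK, cornerLineDescent_of_cornerIrrelevanceTame⟩

/-- THE LOGICAL POSITION OF THE CRUX (lead c5 census, kernel-checked): granted `CardyDiluteOrbit.CardyIK` (stmt-5913), the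
following are all equivalent — (1) the crux `CornerLineDescent` (stmt-10964); (2) the sibling crux
`CardyDiluteOrbit.IKBondBridge` (stmt-5914: same-mesh `o(1)` agreement of IK and standard bond-`ℤ²` crude crossing
probabilities, every rectangle); (3) rate-free corner irrelevance at every conformal rectangle; (4) rate-free corner
irrelevance at every TAME conformal rectangle.  (2) ⇒ (1) and (4) ⇒ (1) hold outright (p107327,
`cornerLineDescent_of_cornerIrrelevanceTame`). [folklore] -/
theorem cornerLineDescent_tfae_position_of_cardyIK
    (hIK : Summit.CriticalPhenomena.CardyFormulaZ2.Theses.CardyDiluteOrbit.CardyIK) :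
    List.TFAE
      [Summit.CriticalPhenomena.CardyFormulaZ2.Theses.CardyIKTransport.CornerLineDescent,
        Summit.CriticalPhenomena.CardyFormulaZ2.Theses.CardyDiluteOrbit.IKBondBridge,
        ∀ R : ConformalRectangle,
          Tendsto (fun δ => gaugeCrossingProb pIK R δ - gaugeCrossingProb 0 R δ) (𝓝[>] 0) (𝓝 0),
        ∀ R : ConformalRectangle,
          (∃ G : ℂ → ℂ, ∃ r : ℝ, 1 < r ∧ DifferentiableOn ℂ G (Metric.ball 0 r) ∧ Set.InjOn G (Metric.ball 0 r) ∧
            R.carrier = G '' Metric.ball 0 1) →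
          Tendsto (fun δ => gaugeCrossingProb pIK R δ - gaugeCrossingProb 0 R δ) (𝓝[>] 0) (𝓝 0)] := by
  tfae_have 1 ↔ 2 := cornerLineDescent_iff_ikBondBridge_of_cardyIK hIK
  tfae_have 1 ↔ 3 := cornerLineDescent_iff_cornerIrrelevance_of_cardyIK hIK
  tfae_have 1 ↔ 4 := cornerLineDescent_iff_cornerIrrelevanceTame_of_cardyIK hIK
  tfae_finish

end Summit.CriticalPhenomena.CardyFormulaZ2.Theorems.CornerLineDescent.SymmetricSeed
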